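import Summits.Ventures.QEC.Census.CertScanSplit
import Summits.Ventures.QEC.Census.HB.HB90b.BZData
import HarnessLib

/-!
# `HB90b` — `bz` certificate, side Z: ENUMERATION verdicts 1/4, tier KERNEL (CERTIFIED: decide +kernel; axioms ⊆ {propext, Classical.choice, Quot.sound})

For each (block `b`, matrix `i`) listed: `cert.bzZEnum bzData b i = true` by `native_decide` — the
Brouwer–Zimmermann replay of matrix `i` of block `b`: every codeword `u · G_i` with `1 ≤ |u| ≤ t_i` has weight
`> wmax` or is allow-listed (CERT-FORMAT C4 / C17 (7)); tactic `decide +kernel`. KERNEL tier: each matrix ≲ 4·10⁵ codewords (type-10 22:34:29Z: 1–6·10³ visits/s in the kernel); `set_option maxHeartbeats 1000000` per theorem because one matrix exceeds the default deterministic budget of the kernel (qec-search-7: BB90 matrix of 1.6·10⁵ codewords timed out at 200000), memory guard untouched.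
Structure (`BZStructZ`), information sets (`BZInfoSetsZ*`) and bounds (`BZBoundsZ`) are KERNEL files.
-/

namespace Summit.Ventures.QEC.Census.HB90b

set_option maxHeartbeats 1000000 in
/-- Block 0, matrix 0: the BZ enumeration verdict (`decide +kernel`; 15226 codewords). -/
theorem enumZ_0_0 : HB90b.cert.bzZEnum HB90b.bzData 0 0 = true := by
  decide +kernel

set_option maxHeartbeats 1000000 in
/-- Block 0, matrix 1: the BZ enumeration verdict (`decide +kernel`; 15226 codewords). -/
theorem enumZ_0_1 : HB90b.cert.bzZEnum HB90b.bzData 0 1 = true := by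
  decide +kernel

set_option maxHeartbeats 1000000 in
/-- Block 1, matrix 0: the BZ enumeration verdict (`decide +kernel`; 15226 codewords). -/
theorem enumZ_1_0 : HB90b.cert.bzZEnum HB90b.bzData 1 0 = true := by
  decide +kernel

set_option maxHeartbeats 1000000 in
/-- Block 1, matrix 1: the BZ enumeration verdict (`decide +kernel`; 15226 codewords). -/
theorem enumZ_1_1 : HB90b.cert.bzZEnum HB90b.bzData 1 1 = true := by
  decide +kernel

set_option maxHeartbeats 1000000 in
/-- Block 2, matrix 0: the BZ enumeration verdict (`decide +kernel`; 15226 codewords). -/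
theorem enumZ_2_0 : HB90b.cert.bzZEnum HB90b.bzData 2 0 = true := by
  decide +kernel

set_option maxHeartbeats 1000000 in
/-- Block 2, matrix 1: the BZ enumeration verdict (`decide +kernel`; 15226 codewords). -/
theorem enumZ_2_1 : HB90b.cert.bzZEnum HB90b.bzData 2 1 = true := by
  decide +kernel

set_option maxHeartbeats 1000000 in
/-- Block 3, matrix 0: the BZ enumeration verdict (`decide +kernel`; 15226 codewords). -/
theorem enumZ_3_0 : HB90b.cert.bzZEnum HB90b.bzData 3 0 = true := by
  decide +kernel

set_option maxHeartbeats 1000000 in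
/-- Block 3, matrix 1: the BZ enumeration verdict (`decide +kernel`; 15226 codewords). -/
theorem enumZ_3_1 : HB90b.cert.bzZEnum HB90b.bzData 3 1 = true := by
  decide +kernel

set_option maxHeartbeats 1000000 in
/-- Block 4, matrix 0: the BZ enumeration verdict (`decide +kernel`; 15226 codewords). -/
theorem enumZ_4_0 : HB90b.cert.bzZEnum HB90b.bzData 4 0 = true := by
  decide +kernel

end Summit.Ventures.QEC.Census.HB90b
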